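import Summits.QuantumAdvantage.AdviceFreeQNC0.CubeTransfer
import Summits.QuantumAdvantage.AdviceFreeQNC0.WindowDegree
import HarnessLib

/-!
# Cell qa-qnc0 (route RingFrame, crux α; lines `tensor` rung S1 and `product`): polynomials of
# `𝔽₂`-degree `< m` have even weight — Reed–Muller duality in the concrete form the tensor line needs

Planner qa-qnc0-p2 (S1-REFUTED.md §G, asks N-1/N-2, ingredient list): "RM duality in the concrete
form actually needed: if `deg c ≤ d` and `deg h ≤ m − d − 1` then `Σ_v c(v)h(v) = 0` (`deg(ch) ≤ m−1`
⇒ even weight)".  PROVED here from the tree: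

* `sum_univ_eq_zero_of_mem_lowDeg`: `Σ_{v ∈ {0,1}^m} g(v) = 0` for every `g` of `𝔽₂`-degree `≤ D`
  with `D + 1 ≤ m` — the iterated-derivative identity `sum_powerset_lowDeg_cubeVertex_eq_zero`
  (`CubeTransfer.lean`) at the base point `0` with the `m` unit vectors as directions, re-indexed
  through the bijection `S ↦ 1_S` between subsets of `[m]` and points of the cube
  (`cubeVertex_zero_unitVec`);
* `even_card_of_hasDeg`: a Boolean function of degree `≤ D < m` has an even number of ones
  (`RM(D, m) ⊆` even-weight code);
* `even_card_and_of_hasDeg` / `sum_indicator_mul_eq_zero_of_hasDeg`: if `deg c ≤ d`, `deg h ≤ d'`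
  and `d + d' + 1 ≤ m` then `#{v : c v ∧ h v}` is even, i.e. `Σ_v [c v]·[h v] = 0` in `𝔽₂`
  (`hasDeg_and`, `WindowDegree.lean`) — with `d' = m − d − 1` this is `RM(d,m)^⊥ ⊇ RM(m−d−1,m)`,
  the half of Reed–Muller duality used in THEOREM A (5) of S1-REFUTED.md.

WHAT THIS IS NOT: not the equality `RM(d,m)^⊥ = RM(m−d−1,m)` (only the inclusion needed); nothing on
`UnionBound`/`LiftOneStrict`/α. [folklore; MacWilliams–Sloane Ch. 13 Thm 4]
-/

namespace Summit.QuantumAdvantage.AdviceFreeQNC0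

open Finset
open Literature.Computability.MetaComplexity Literature.Computability.MetaComplexity.Smolensky

variable {m : ℕ}

/-! ### Subsets of `[m]` as points of the cube -/

/-- the `i`-th unit vector of `{0,1}^m`. -/
def unitVec (i : Fin m) : Fin m → Bool := fun j => decide (j = i)

/-- the indicator point `1_S ∈ {0,1}^m` of a subset `S ⊆ [m]`. -/
def indVec (S : Finset (Fin m)) : Fin m → Bool := fun j => decide (j ∈ S)

/-- `S ↦ 1_S` is a bijection `Finset (Fin m) ≃ (Fin m → Bool)`. -/
def indVecEquiv : Finset (Fin m) ≃ (Fin m → Bool) where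
  toFun := indVec
  invFun := fun v => univ.filter fun j => v j = true
  left_inv := fun S => by ext j; simp [indVec]
  right_inv := fun v => by funext j; simp [indVec]

/-- `indVecEquiv` is `indVec`. [folklore] -/
theorem indVecEquiv_apply (S : Finset (Fin m)) : indVecEquiv S = indVec S := rfl

/-- The cube vertex `0 + Σ_{i ∈ S} e_i` is the indicator point `1_S`. [folklore] -/
theorem cubeVertex_zero_unitVec (S : Finset (Fin m)) :
    cubeVertex (fun _ : Fin m => false) (fun i : Fin m => unitVec i) S = indVec S := by
  funext j
  unfold cubeVertex indVec unitVec
  have hfilter : (S.filter fun i : Fin m => decide (j = i) = true) = S.filter fun i => j = i := by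
    refine Finset.filter_congr fun i _ => ?_
    simp
  rw [hfilter]
  by_cases hj : j ∈ S
  · have e : (S.filter fun i => j = i) = {j} := by
      ext i
      simp only [Finset.mem_filter, Finset.mem_singleton]
      constructor
      · rintro ⟨_, rfl⟩; rfl
      · rintro rfl; exact ⟨hj, rfl⟩
    rw [e, Finset.card_singleton]
    simp [hj]
  · have e : (S.filter fun i => j = i) = ∅ := by
      refine Finset.filter_eq_empty_iff.2 fun i hi h => hj ?_
      rw [h]; exact hi
    rw [e, Finset.card_empty]
    simp [hj]

/-! ### The whole-cube sum of a polynomial of degree `< m` vanishes -/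

/-- **`Σ_{v ∈ {0,1}^m} g(v) = 0`** for `g` of `𝔽₂`-degree `≤ D` with `D + 1 ≤ m`. [folklore] -/
theorem sum_univ_eq_zero_of_mem_lowDeg {D : ℕ} {g : CubeFn (ZMod 2) m} (hg : g ∈ lowDeg (ZMod 2) m D)
    (hm : D + 1 ≤ m) : ∑ v : Fin m → Bool, g v = 0 := by
  have h := sum_powerset_lowDeg_cubeVertex_eq_zero (fun _ : Fin m => false) (fun i : Fin m => unitVec i)
    univ D g hg (by rw [Finset.card_univ, Fintype.card_fin]; exact hm)
  rw [Finset.powerset_univ] at h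
  simp_rw [cubeVertex_zero_unitVec] at h
  rw [← Equiv.sum_comp indVecEquiv g]
  exact h

/-- **Even weight.** A Boolean function on `{0,1}^m` of degree `≤ D` with `D + 1 ≤ m` takes the value
`1` an even number of times. [folklore] -/
theorem even_card_of_hasDeg {D : ℕ} {f : (Fin m → Bool) → Bool} (hf : HasDeg f D) (hm : D + 1 ≤ m) :
    Even (univ.filter fun v : Fin m → Bool => f v = true).card := by
  have h := sum_univ_eq_zero_of_mem_lowDeg hf hm
  have e : (∑ v : Fin m → Bool, (if f v = true then (1 : ZMod 2) else 0)) =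
      ((univ.filter fun v : Fin m → Bool => f v = true).card : ZMod 2) := by
    rw [Finset.sum_boole]
  have h' : ((univ.filter fun v : Fin m → Bool => f v = true).card : ZMod 2) = 0 := by
    rw [← e]; exact h
  exact (ZMod.natCast_eq_zero_iff_even).1 h'

/-- **Reed–Muller duality, concrete form.** If `deg c ≤ d`, `deg h ≤ d'` and `d + d' + 1 ≤ m`, then
`c` and `h` meet in an even number of points. (With `d' = m − d − 1`: `RM(m−d−1, m) ⊆ RM(d, m)^⊥`.)
[folklore] -/
theorem even_card_and_of_hasDeg {d d' : ℕ} {c h : (Fin m → Bool) → Bool} (hc : HasDeg c d)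
    (hh : HasDeg h d') (hm : d + d' + 1 ≤ m) :
    Even (univ.filter fun v : Fin m → Bool => (c v && h v) = true).card :=
  even_card_of_hasDeg (hasDeg_and hc hh) hm

/-- The same in `𝔽₂`: `Σ_v [c v]·[h v] = 0`. [folklore] -/
theorem sum_indicator_mul_eq_zero_of_hasDeg {d d' : ℕ} {c h : (Fin m → Bool) → Bool}
    (hc : HasDeg c d) (hh : HasDeg h d') (hm : d + d' + 1 ≤ m) :
    (∑ v : Fin m → Bool, (if c v = true then (1 : ZMod 2) else 0) *
      (if h v = true then (1 : ZMod 2) else 0)) = 0 := by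
  have hev := even_card_and_of_hasDeg hc hh hm
  have e : (∑ v : Fin m → Bool, (if c v = true then (1 : ZMod 2) else 0) *
      (if h v = true then (1 : ZMod 2) else 0)) =
      ∑ v : Fin m → Bool, (if (c v && h v) = true then (1 : ZMod 2) else 0) := by
    refine Finset.sum_congr rfl fun v _ => ?_
    cases c v <;> cases h v <;> simp
  rw [e, Finset.sum_boole]
  exact (ZMod.natCast_eq_zero_iff_even).2 hev

end Summit.QuantumAdvantage.AdviceFreeQNC0
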